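/-
Copyright: the b2b-balaban T⁴-continuum CRUX team, row NE7b leaf lineage `t4-ne7b-formalise-leaf-03` (gen 156). Project licence.
-/
import Summits.QuantumFields.BalabanUV.T4Continuum.Spine.NE7b.PeriodicSupTorusCarrier

/-!
# THE BLOCK STRUCTURE AND THE DIRICHLET FORM OF THE SKELETON ON THE TORUS CARRIERS: the fine torus `(ℤ∕(n+1)s)^d` FIBRES OVER
# the coarse torus `(ℤ∕s)^d` through the block chart — `(y, z) ↦ siteOf (chart n (windowMap y) z)` is a bijection
# `Site d s × (Fin d → Fin (n+1)) ≃ Site d ((n+1)s)`, the torus block map `x ↦ siteOf (blk n (windowMap x))` commutes with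
# periodisation, `Σ_x F x = Σ_y Σ_{p ∈ B n (windowMap y)} F (siteOf p)`; hence THE ADJOINTNESS of block lift and block mean
# `Σ_x c(blk x)·h x = (n+1)^d Σ_y c y·(Q′h) y` (a block-constant covector kills the torus fibre `ker Q′`); and THE TORUS FORM OF THE
# SITE OPERATOR `A = Δ^η + aQ′*Q′` IS SYMMETRIC, `Σ_x ψ x·(Aφ) x = Σ_x φ x·(Aψ) x`, its matrix being the periodised kernel
# `Σ′_m AX(windowMap x, windowMap z + (n+1)s·m)` (row NE7b, node U5c; PTC's carriers, (55) `AX_translate` ∕ `blk_translate`,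
# `B6QGQLower276.AX_symm`, `Beta.tsum_eq_sum_tsum_imageShift` BY NAME; [folklore])

Cell `pub-balaban`, sub-cell `t4`, spine estimate NE7b (`T4WeightBudget.RelWeightBound`; the cell's OWN estimate — NOT PRINTED in
[Bałaban 1983–89], NOT PROVED).  Crux-route work under `Spine/NE7b/` by a row leaf (`t4-ne7b-formalise-leaf-03` gen 156) under
FREEZE (0)'s crux-prover clause, on the row OWNER's located item ([NE7bP1-G116-HANDOFF] NEXT (3)(iii): «the variational junction on
the torus (effective action `V∘σt`, its gradient = SISL's next equation map × block volume, its Hessian = (65)'s next-scale operator)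
— leaf-06's HardStep road has it ABSTRACTLY (HSAH), an instance needs the torus Dirichlet form on leaf-03's `Site` carriers»);
NOTHING of Bałaban's is named as a Lean object, valued or asserted; no `T4Continuum/Support` leaf typed; no `def`, no notation (the
torus block map, the block chart and the periodised kernel are written out; every operator enters through its DISPLAYED action and
every law is stated FOR ANY maps with those actions); zero `sorry`.  Imports (BY NAME): this lineage's PTC `…PeriodicSupTorusCarrier`
(`exists_windowMap_siteOf`, `siteOf_add_smul`, `imageShift_eq_add_smul`, `natCast_mul_smul_eq`; through it the OWNER's (72)
`…AugmentedInversePeriodic.blockAvg_periodic`, (55) `…OneShotChartTorusRowsZd.AX_translate` ∕ `blk_translate`, the Literature site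
matrix `B6QGQLower276` (`AX`, `AX_symm`, `chart`, `chart_inj`, `blk_chart`, `locFin`, `locFin_chart`, `chart_blk_locFin`, `B`, `mem_B`,
`blk`, `loc`, `side`), `B5Hk103ScalarZd` (`nbhd`, `tsum_AX_mul`, `AX_eq_zero_of_not_mem`) and the torus ↔ window dictionary
`Beta.InfiniteVolume` ∕ `Beta.VolumeConvolution` (`Site`, `siteOf`, `windowMap`, `siteOf_windowMap`, `imageShift`, `siteOf_imageShift`,
`tsum_eq_sum_tsum_imageShift`)).

WHY (located).  The sup road's torus objects (PTC ∕ SBT ∕ SLT ∕ SBTL, the OWNER's (72)–(74), (88)) are all READ THROUGH window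
representatives: `Q′`, `A`, `P`, `σ`, `Dσ`, `C̃` act on `ℓ^∞(ℤ^d)` and the torus statements are their restrictions to the periodic
subspaces.  What a VARIATIONAL statement on the torus needs and the tree does not hold is the torus-side STRUCTURE: (i) that the fine
torus is fibred over the coarse torus by the block chart with fibres `≃ Fin d → Fin (n+1)` — so that finite sums over the fine torus
split blockwise and the pairing `Σ_x f x·g x` makes the block lift `c ↦ c ∘ blk` the adjoint of `(n+1)^d Q′` — and (ii) that the site
operator's torus form is symmetric, so that `φ ↦ ½Σ_x φ x·(Aφ) x + Σ_x v(φ x)` has gradient `Aφ + v′∘φ` in that pairing.  With (i) the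
sitewise equation of the background («`Aσ + u∘σ` is block-constant», SBTL) says exactly that the action's differential at `σt w`
KILLS THE TORUS FIBRE `ker Q′t` — the fibre-criticality `…HardStepActionHessian` consumes — and evaluates on SLT's response `Dt`
(torus block means `= 1`) to `(n+1)^d·⟨λ(w), k⟩` with `λ(w) = Q′(Aσ + u∘σ)` the torus reading of `…SupInductiveStepLattice`'s next
equation map.  This file types (i) and (ii); the calculus junction is the successor file.

WHAT IS PROVED ([folklore]; `ℓ^∞ := lp (fun _ : X d => ℝ) ∞`; coarse period `s ≥ 1`, fine period `(n+1)·s`; the torus block map is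
written out as `siteOf d s (blk n (windowMap d ((n+1)s) x))`):
* §1 `chart_add` (`chart n (y + t) z = chart n y z + side•t`), `loc_add_side_smul` ∕ `locFin_add_side_smul` (local coordinates are
  `side`-periodic), **`blockOf_siteOf`** (`blk` commutes with periodisation: the torus block of `siteOf q` is `siteOf (blk n q)`),
  `locFin_windowMap_siteOf`, `blockOf_siteOf_of_mem` (`p ∈ B n (windowMap y)` ⟹ the torus block of `siteOf p` is `y`),
  **`siteOf_chart_injective`**, **`siteOf_chart_surjective`**, `siteOf_chart_bijective` (THE BLOCK CHART OF THE TORI), and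
  **`sum_fine_eq_sum_blocks`** (`Σ_x F x = Σ_y Σ_{p ∈ B n (windowMap y)} F (siteOf p)`).
* §2 **`sum_blockLift_mul`** (`Σ_x c(bt x)·h x = Σ_y c y·Σ_{p ∈ B n (windowMap y)} h (siteOf p)`), **`sum_blockLift_mul_eq_blockAvg`**
  (for ANY `Dop` with the block-average action and carrier maps `Ef ∕ Rc` with their displayed actions:
  `Σ_x c(bt x)·h x = (n+1)^d·Σ_y c y·(Rc (Dop (Ef h))) y`), `sum_blockLift_mul_eq_zero` (fibre-criticality: `Rc (Dop (Ef h)) = 0` ⟹ the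
  pairing vanishes), `sum_blockLift_mul_of_blockAvg_eq` (on a section, `Rc (Dop (Ef h)) = k`: `= (n+1)^d Σ_y c y·k y`), and the reading
  **`apply_windowMap_of_blockConst`** ∕ `restrict_of_blockConst` (a periodic block-constant lattice field — SBTL's sitewise equation —
  restricts to the block lift of the window restriction of its block mean).
* §3 `summable_AX_mul_comp_siteOf`, **`siteOp_periodise_apply`** (`(A(Ef φ))(p) = Σ_z (Σ′_m AX(p, windowMap z + (n+1)s·m))·φ z`),
  `AX_add_period_smul` (`AX(p, q + N·m) = AX(q, p − N·m)`), **`periodisedKernel_symm`**, and **`torus_form_symm`**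
  (`Σ_x ψ x·(Rf (A (Ef φ))) x = Σ_x φ x·(Rf (A (Ef ψ))) x` for ANY `Aop ∕ Ef ∕ Rf` with the displayed actions) —
  THE DIRICHLET FORM OF `Δ^η + aQ′*Q′` ON THE `Beta.Site` CARRIERS.
* §4 toy: at `n = 0`, `s = 1` the block chart is onto the one-point torus.

HONEST (what this is NOT).  Finite-sum ∕ carrier bookkeeping on the tori: no estimate, no constant; positivity of the form and its
spectral floor are NOT typed here (they are (47)∕(72)'s business through the chart); the calculus junction (gradient ∕ Hessian of the
torus effective action) is the successor file; cubic periods only (rectangular `B5Prop11Plancherel.Tor` carriers not treated); scalar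
skeleton, not the covariant operators ((A3), NC-NE7b-α UNRULED); nothing of Bałaban's.  BY-NAME EFFECT ON THE WALL: NONE.  NE7b NOT
PRINTED ∕ NOT PROVED; spine PROVED 0∕9; rung (B)+1 on a FINITE torus — NOT infinite volume, NOT the mass gap, NOT Clay.  HONEST
DEPENDENCY: continuum YM on T⁴ ⇐ BetaPertH ∧ nine spine estimates (0∕9 proved); BetaPertH ⇐ (D1) ∧ (D4) ∧ CAP+tail; G-an2-4 gates
asym, D1 and NE2∕3∕4.
-/

set_option autoImplicit false

noncomputable section

namespace Summit.QuantumFields.BalabanUV.T4Continuum.NE7b.SupTorusDirichletForm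

open scoped ENNReal
open Literature.MathematicalPhysics.QuantumFieldTheory.Balaban1983to89
open B6QGQLower276 (X blk B side AX AX_symm chart chart_inj blk_chart loc locFin locFin_val locFin_chart chart_blk_locFin mem_B)
open B5Hk103ScalarZd (nbhd tsum_AX_mul AX_eq_zero_of_not_mem)
open Beta (Site siteOf windowMap imageShift siteOf_windowMap siteOf_imageShift tsum_eq_sum_tsum_imageShift)
open OneShotChartTorusRowsZd (AX_translate blk_translate)
open AugmentedInversePeriodic (blockAvg_periodic)
open PeriodicSupTorusCarrier (exists_windowMap_siteOf siteOf_add_smul imageShift_eq_add_smul natCast_mul_smul_eq)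

variable {d : ℕ}

/-! ## §1. The fine torus fibres over the coarse torus through the block chart -/

/-- The block chart is additive in the block label: `chart n (y + t) z = chart n y z + side•t`. [folklore] -/
theorem chart_add (n : ℕ) (y t : X d) (z : Fin d → Fin (n + 1)) : chart n (y + t) z = chart n y z + side n • t := by
  funext μ
  simp only [chart, Pi.add_apply, Pi.smul_apply, smul_eq_mul]
  ring

/-- Local coordinates are `side`-periodic: `loc n (p + side•t) = loc n p`. [folklore] -/
theorem loc_add_side_smul (n : ℕ) (p t : X d) (μ : Fin d) : loc n (p + side n • t) μ = loc n p μ := by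
  show (p + side n • t) μ % side n = p μ % side n
  rw [Pi.add_apply, Pi.smul_apply, smul_eq_mul, Int.add_mul_emod_self_left]

/-- `locFin n (p + side•t) = locFin n p`. [folklore] -/
theorem locFin_add_side_smul (n : ℕ) (p t : X d) : locFin n (p + side n • t) = locFin n p := by
  funext μ
  apply Fin.ext
  have h1 := locFin_val n (p + side n • t) μ
  have h2 := locFin_val n p μ
  rw [loc_add_side_smul] at h1
  exact_mod_cast h1.trans h2.symm

/-- **THE BLOCK MAP COMMUTES WITH PERIODISATION**: the torus block (in `Site d s`) of the fine torus site `siteOf q`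
(`q ∈ ℤ^d`, fine period `(n+1)s`) is `siteOf (blk n q)`. [folklore] -/
theorem blockOf_siteOf (n s : ℕ) [NeZero s] (q : X d) :
    siteOf d s (blk n (windowMap d ((n + 1) * s) (siteOf d ((n + 1) * s) q))) = siteOf d s (blk n q) := by
  obtain ⟨m, hm⟩ := exists_windowMap_siteOf ((n + 1) * s) q
  rw [hm, natCast_mul_smul_eq, blk_translate, siteOf_add_smul]

/-- The local coordinates of a fine torus site are read off any representative: `locFin n (windowMap (siteOf q)) = locFin n q`.
[folklore] -/
theorem locFin_windowMap_siteOf (n s : ℕ) [NeZero s] (q : X d) :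
    locFin n (windowMap d ((n + 1) * s) (siteOf d ((n + 1) * s) q)) = locFin n q := by
  obtain ⟨m, hm⟩ := exists_windowMap_siteOf ((n + 1) * s) q
  rw [hm, natCast_mul_smul_eq, locFin_add_side_smul]

/-- **A lattice block periodises into one torus block**: for `p ∈ B n (windowMap y)` the torus block of `siteOf p` is `y`. [folklore] -/
theorem blockOf_siteOf_of_mem (n s : ℕ) [NeZero s] {y : Site d s} {p : X d} (hp : p ∈ B n (windowMap d s y)) :
    siteOf d s (blk n (windowMap d ((n + 1) * s) (siteOf d ((n + 1) * s) p))) = y := by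
  rw [blockOf_siteOf, mem_B.1 hp, siteOf_windowMap]

/-- **THE BLOCK CHART OF THE TORI IS INJECTIVE**: `(y, z) ↦ siteOf (chart n (windowMap y) z)` from `Site d s × (Fin d → Fin (n+1))`
to `Site d ((n+1)s)` (read the torus block and the local coordinates back). [folklore] -/
theorem siteOf_chart_injective (n s : ℕ) [NeZero s] :
    Function.Injective (fun yz : Site d s × (Fin d → Fin (n + 1)) =>
      siteOf d ((n + 1) * s) (chart n (windowMap d s yz.1) yz.2)) := by
  rintro ⟨y, z⟩ ⟨y', z'⟩ h
  have hy : y = y' := by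
    have hb := congrArg (fun x => siteOf d s (blk n (windowMap d ((n + 1) * s) x))) h
    simp only [blockOf_siteOf, blk_chart, siteOf_windowMap] at hb
    exact hb
  have hz : z = z' := by
    have hl := congrArg (fun x => locFin n (windowMap d ((n + 1) * s) x)) h
    simp only [locFin_windowMap_siteOf, locFin_chart] at hl
    exact hl
  rw [hy, hz]

/-- **THE BLOCK CHART OF THE TORI IS SURJECTIVE**: every fine torus site is `siteOf (chart n (windowMap y) z)` with `y` its torus block
and `z` its local coordinates. [folklore] -/
theorem siteOf_chart_surjective (n s : ℕ) [NeZero s] :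
    Function.Surjective (fun yz : Site d s × (Fin d → Fin (n + 1)) =>
      siteOf d ((n + 1) * s) (chart n (windowMap d s yz.1) yz.2)) := by
  intro x
  set q : X d := windowMap d ((n + 1) * s) x with hq
  refine ⟨(siteOf d s (blk n q), locFin n q), ?_⟩
  obtain ⟨m, hm⟩ := exists_windowMap_siteOf s (blk n q)
  show siteOf d ((n + 1) * s) (chart n (windowMap d s (siteOf d s (blk n q))) (locFin n q)) = x
  rw [hm, chart_add, chart_blk_locFin, ← natCast_mul_smul_eq, siteOf_add_smul, hq, siteOf_windowMap]

/-- The block chart of the tori is a bijection `Site d s × (Fin d → Fin (n+1)) → Site d ((n+1)s)`. [folklore] -/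
theorem siteOf_chart_bijective (n s : ℕ) [NeZero s] :
    Function.Bijective (fun yz : Site d s × (Fin d → Fin (n + 1)) =>
      siteOf d ((n + 1) * s) (chart n (windowMap d s yz.1) yz.2)) :=
  ⟨siteOf_chart_injective n s, siteOf_chart_surjective n s⟩

/-- **FINITE SUMS OVER THE FINE TORUS SPLIT BLOCKWISE**: `Σ_x F x = Σ_y Σ_{p ∈ B n (windowMap y)} F (siteOf p)` — the outer sum over
the coarse torus, the inner one over the lattice block of the window representative. [folklore] -/
theorem sum_fine_eq_sum_blocks {M : Type*} [AddCommMonoid M] (n s : ℕ) [NeZero s] (F : Site d ((n + 1) * s) → M) :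
    ∑ x, F x = ∑ y : Site d s, ∑ p ∈ B n (windowMap d s y), F (siteOf d ((n + 1) * s) p) := by
  rw [← (siteOf_chart_bijective (d := d) n s).sum_comp F, Fintype.sum_prod_type]
  refine Finset.sum_congr rfl fun y _ => ?_
  simp only [B]
  rw [Finset.sum_image fun z _ z' _ h => (chart_inj h).2]

/-! ## §2. Block lift and block mean are adjoint on the torus; block-constant fields read through the block map -/

/-- **THE BLOCK LIFT PAIRS BLOCKWISE**: `Σ_x c(bt x)·h x = Σ_y c y·Σ_{p ∈ B n (windowMap y)} h (siteOf p)`, `bt` the torus block map.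
[folklore] -/
theorem sum_blockLift_mul (n s : ℕ) [NeZero s] (c : Site d s → ℝ) (h : Site d ((n + 1) * s) → ℝ) :
    ∑ x, c (siteOf d s (blk n (windowMap d ((n + 1) * s) x))) * h x
      = ∑ y : Site d s, c y * ∑ p ∈ B n (windowMap d s y), h (siteOf d ((n + 1) * s) p) := by
  rw [sum_fine_eq_sum_blocks n s]
  refine Finset.sum_congr rfl fun y _ => ?_
  rw [Finset.mul_sum]
  exact Finset.sum_congr rfl fun p hp => by rw [blockOf_siteOf_of_mem n s hp]

section Carriers

variable (n s : ℕ) [NeZero s]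
  {Dop : lp (fun _ : X d => ℝ) ∞ →L[ℝ] lp (fun _ : X d => ℝ) ∞}
  (hD : ∀ (f : lp (fun _ : X d => ℝ) ∞) (y : X d), Dop f y = (((n : ℝ) + 1) ^ d)⁻¹ * ∑ p ∈ B n y, f p)
  {Ef : (Site d ((n + 1) * s) → ℝ) →L[ℝ] lp (fun _ : X d => ℝ) ∞}
  (hEf : ∀ (g : Site d ((n + 1) * s) → ℝ) (q : X d), Ef g q = g (siteOf d ((n + 1) * s) q))
  {Rf : lp (fun _ : X d => ℝ) ∞ →L[ℝ] (Site d ((n + 1) * s) → ℝ)}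
  (hRf : ∀ (h : lp (fun _ : X d => ℝ) ∞) (x : Site d ((n + 1) * s)), Rf h x = h (windowMap d ((n + 1) * s) x))
  {Rc : lp (fun _ : X d => ℝ) ∞ →L[ℝ] (Site d s → ℝ)}
  (hRc : ∀ (h : lp (fun _ : X d => ℝ) ∞) (x : Site d s), Rc h x = h (windowMap d s x))

include hD hEf hRc in
/-- **BLOCK LIFT AND BLOCK MEAN ARE ADJOINT ON THE TORUS** (up to the block volume): for ANY `Dop` with the block-average action and
carrier maps `Ef` (fine periodisation) ∕ `Rc` (coarse window restriction) with their displayed actions,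
`Σ_x c(bt x)·h x = (n+1)^d·Σ_y c y·(Rc (Dop (Ef h))) y`. [folklore] -/
theorem sum_blockLift_mul_eq_blockAvg (c : Site d s → ℝ) (h : Site d ((n + 1) * s) → ℝ) :
    ∑ x, c (siteOf d s (blk n (windowMap d ((n + 1) * s) x))) * h x
      = ((n : ℝ) + 1) ^ d * ∑ y : Site d s, c y * Rc (Dop (Ef h)) y := by
  have hvol : (((n : ℝ) + 1) ^ d) ≠ 0 := by positivity
  rw [sum_blockLift_mul, Finset.mul_sum]
  refine Finset.sum_congr rfl fun y _ => ?_
  rw [hRc, hD]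
  simp only [hEf]
  rw [mul_left_comm, mul_inv_cancel_left₀ hvol]

include hD hEf hRc in
/-- **FIBRE-CRITICALITY**: a block-constant covector kills the torus fibre — if the torus block means of `h` vanish
(`Rc (Dop (Ef h)) = 0`), then `Σ_x c(bt x)·h x = 0` for every coarse `c`. [folklore] -/
theorem sum_blockLift_mul_eq_zero (c : Site d s → ℝ) {h : Site d ((n + 1) * s) → ℝ} (hh : Rc (Dop (Ef h)) = 0) :
    ∑ x, c (siteOf d s (blk n (windowMap d ((n + 1) * s) x))) * h x = 0 := by
  rw [sum_blockLift_mul_eq_blockAvg n s hD hEf hRc, hh]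
  simp

include hD hEf hRc in
/-- **ON A SECTION THE PAIRING IS THE COARSE PAIRING TIMES THE BLOCK VOLUME**: if the torus block means of `h` are `k`
(`Rc (Dop (Ef h)) = k` — SLT's response `h = Dt k`), then `Σ_x c(bt x)·h x = (n+1)^d·Σ_y c y·k y`. [folklore] -/
theorem sum_blockLift_mul_of_blockAvg_eq (c : Site d s → ℝ) {h : Site d ((n + 1) * s) → ℝ} {k : Site d s → ℝ}
    (hh : Rc (Dop (Ef h)) = k) :
    ∑ x, c (siteOf d s (blk n (windowMap d ((n + 1) * s) x))) * h x = ((n : ℝ) + 1) ^ d * ∑ y : Site d s, c y * k y := by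
  rw [sum_blockLift_mul_eq_blockAvg n s hD hEf hRc, hh]

omit [NeZero s] in
/-- **A PERIODIC BLOCK-CONSTANT LATTICE FIELD READS THROUGH THE TORUS BLOCK MAP** (bare functions): if `F` is `side•(s•t)`-periodic
and equals its own block average at every site (SBTL's sitewise equation for `F = A(σ) + u∘σ`), then at every fine torus site
`F (windowMap x) = (block average of F over B n (windowMap (bt x)))`. [folklore] -/
theorem apply_windowMap_of_blockConst [NeZero s] {F : X d → ℝ}
    (hper : ∀ q t : X d, F (q + side n • ((s : ℤ) • t)) = F q)
    (hF : ∀ p : X d, F p = (((n : ℝ) + 1) ^ d)⁻¹ * ∑ p' ∈ B n (blk n p), F p') (x : Site d ((n + 1) * s)) :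
    F (windowMap d ((n + 1) * s) x)
      = (((n : ℝ) + 1) ^ d)⁻¹ * ∑ p' ∈ B n (windowMap d s (siteOf d s (blk n (windowMap d ((n + 1) * s) x)))), F p' := by
  obtain ⟨m, hm⟩ := exists_windowMap_siteOf s (blk n (windowMap d ((n + 1) * s) x))
  rw [hm, blockAvg_periodic n s hper, ← hF]

include hD hRf hRc in
/-- **THE SAME IN CARRIER FORM**: for `F ∈ ℓ^∞` periodic and block-constant (`F p = (Dop F)(blk n p)`),
`Rf F x = (Rc (Dop F))(bt x)` — the fine restriction of `F` is the block lift of the coarse restriction of its block mean. [folklore] -/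
theorem restrict_of_blockConst {F : lp (fun _ : X d => ℝ) ∞}
    (hper : ∀ q t : X d, F (q + side n • ((s : ℤ) • t)) = F q) (hF : ∀ p : X d, F p = Dop F (blk n p))
    (x : Site d ((n + 1) * s)) :
    Rf F x = Rc (Dop F) (siteOf d s (blk n (windowMap d ((n + 1) * s) x))) := by
  rw [hRf, hRc, hD]
  exact apply_windowMap_of_blockConst n s hper (fun p => by rw [hF p, hD]) x

end Carriers

/-! ## §3. The torus form of the site operator `Δ^η + aQ′*Q′` is symmetric -/

/-- A site-matrix row against a periodised torus field is a finitely supported family. [folklore] -/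
theorem summable_AX_mul_comp_siteOf (n : ℕ) (a : ℝ) {N : ℕ} (φ : Site d N → ℝ) (p : X d) :
    Summable (fun r : X d => AX n a p r * φ (siteOf d N r)) :=
  summable_of_ne_finset_zero (s := nbhd n p) fun r hr => by rw [AX_eq_zero_of_not_mem a hr, zero_mul]

/-- **THE SITE OPERATOR ACTS ON A TORUS FIELD THROUGH THE PERIODISED KERNEL**: for ANY `Aop` with the site-matrix action and any
periodisation map `Ef` with its displayed action,
`(Aop (Ef φ))(p) = Σ_z (Σ′_m AX(p, windowMap z + (n+1)s·m))·φ z`. [folklore] -/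
theorem siteOp_periodise_apply (n : ℕ) (a : ℝ) (s : ℕ) [NeZero s]
    {Aop : lp (fun _ : X d => ℝ) ∞ →L[ℝ] lp (fun _ : X d => ℝ) ∞}
    (hA : ∀ (f : lp (fun _ : X d => ℝ) ∞) (p : X d), Aop f p = ∑ r ∈ nbhd n p, AX n a p r * f r)
    {Ef : (Site d ((n + 1) * s) → ℝ) →L[ℝ] lp (fun _ : X d => ℝ) ∞}
    (hEf : ∀ (g : Site d ((n + 1) * s) → ℝ) (q : X d), Ef g q = g (siteOf d ((n + 1) * s) q))
    (φ : Site d ((n + 1) * s) → ℝ) (p : X d) :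
    Aop (Ef φ) p
      = ∑ z : Site d ((n + 1) * s),
          (∑' m : X d, AX n a p (windowMap d ((n + 1) * s) z + (((n + 1) * s : ℕ) : ℤ) • m)) * φ z := by
  rw [hA]
  simp only [hEf]
  rw [← tsum_AX_mul, tsum_eq_sum_tsum_imageShift (s := (n + 1) * s) (summable_AX_mul_comp_siteOf n a φ p)]
  refine Finset.sum_congr rfl fun z _ => ?_
  simp only [siteOf_imageShift, siteOf_windowMap]
  simp only [imageShift_eq_add_smul]
  rw [tsum_mul_right]

/-- **THE SITE MATRIX AGAINST A PERIOD TRANSLATE**: `AX(p, q + N·m) = AX(q, p − N·m)` for the fine period `N = (n+1)s`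
((55) `AX_translate` + `AX_symm`). [folklore] -/
theorem AX_add_period_smul (n : ℕ) (a : ℝ) (s : ℕ) (p q m : X d) :
    AX n a p (q + (((n + 1) * s : ℕ) : ℤ) • m) = AX n a q (p + (((n + 1) * s : ℕ) : ℤ) • (-m)) := by
  have h := AX_translate n a (p + (((n + 1) * s : ℕ) : ℤ) • (-m)) q ((s : ℤ) • m)
  rw [← natCast_mul_smul_eq, smul_neg, ← sub_eq_add_neg, sub_add_cancel] at h
  rw [h, smul_neg, ← sub_eq_add_neg]
  exact AX_symm n a _ _

/-- **THE PERIODISED KERNEL IS SYMMETRIC**: `Σ′_m AX(p, q + N·m) = Σ′_m AX(q, p + N·m)`, `N = (n+1)s` (reindex `m ↦ −m`). [folklore] -/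
theorem periodisedKernel_symm (n : ℕ) (a : ℝ) (s : ℕ) (p q : X d) :
    ∑' m : X d, AX n a p (q + (((n + 1) * s : ℕ) : ℤ) • m) = ∑' m : X d, AX n a q (p + (((n + 1) * s : ℕ) : ℤ) • m) := by
  simp only [AX_add_period_smul n a s p q]
  exact (Equiv.neg (X d)).tsum_eq (fun m => AX n a q (p + (((n + 1) * s : ℕ) : ℤ) • m))

/-- **THE TORUS FORM OF THE SITE OPERATOR IS SYMMETRIC** — the Dirichlet form of `Δ^η + aQ′*Q′` on the `Beta.Site` carriers: for ANY
`Aop` with the site-matrix action and carrier maps `Ef` (periodisation) ∕ `Rf` (window restriction) with their displayed actions, and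
all fine torus fields `φ ψ`, `Σ_x ψ x·(Rf (Aop (Ef φ))) x = Σ_x φ x·(Rf (Aop (Ef ψ))) x`. [folklore] -/
theorem torus_form_symm (n : ℕ) (a : ℝ) (s : ℕ) [NeZero s]
    {Aop : lp (fun _ : X d => ℝ) ∞ →L[ℝ] lp (fun _ : X d => ℝ) ∞}
    (hA : ∀ (f : lp (fun _ : X d => ℝ) ∞) (p : X d), Aop f p = ∑ r ∈ nbhd n p, AX n a p r * f r)
    {Ef : (Site d ((n + 1) * s) → ℝ) →L[ℝ] lp (fun _ : X d => ℝ) ∞}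
    (hEf : ∀ (g : Site d ((n + 1) * s) → ℝ) (q : X d), Ef g q = g (siteOf d ((n + 1) * s) q))
    {Rf : lp (fun _ : X d => ℝ) ∞ →L[ℝ] (Site d ((n + 1) * s) → ℝ)}
    (hRf : ∀ (h : lp (fun _ : X d => ℝ) ∞) (x : Site d ((n + 1) * s)), Rf h x = h (windowMap d ((n + 1) * s) x))
    (φ ψ : Site d ((n + 1) * s) → ℝ) :
    ∑ x, ψ x * Rf (Aop (Ef φ)) x = ∑ x, φ x * Rf (Aop (Ef ψ)) x := by
  simp only [hRf, siteOp_periodise_apply n a s hA hEf, Finset.mul_sum]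
  rw [Finset.sum_comm]
  refine Finset.sum_congr rfl fun x _ => Finset.sum_congr rfl fun z _ => ?_
  rw [periodisedKernel_symm n a s (windowMap d ((n + 1) * s) z) (windowMap d ((n + 1) * s) x)]
  ring

/-- **THE SAME FOR THE TORUS OPERATOR `At := Rf ∘ Aop ∘ Ef`** (SLT's spelling of torus operators). [folklore] -/
theorem torus_operator_form_symm (n : ℕ) (a : ℝ) (s : ℕ) [NeZero s]
    {Aop : lp (fun _ : X d => ℝ) ∞ →L[ℝ] lp (fun _ : X d => ℝ) ∞}
    (hA : ∀ (f : lp (fun _ : X d => ℝ) ∞) (p : X d), Aop f p = ∑ r ∈ nbhd n p, AX n a p r * f r)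
    {Ef : (Site d ((n + 1) * s) → ℝ) →L[ℝ] lp (fun _ : X d => ℝ) ∞}
    (hEf : ∀ (g : Site d ((n + 1) * s) → ℝ) (q : X d), Ef g q = g (siteOf d ((n + 1) * s) q))
    {Rf : lp (fun _ : X d => ℝ) ∞ →L[ℝ] (Site d ((n + 1) * s) → ℝ)}
    (hRf : ∀ (h : lp (fun _ : X d => ℝ) ∞) (x : Site d ((n + 1) * s)), Rf h x = h (windowMap d ((n + 1) * s) x))
    (φ ψ : Site d ((n + 1) * s) → ℝ) :
    ∑ x, ψ x * ((Rf.comp Aop).comp Ef) φ x = ∑ x, φ x * ((Rf.comp Aop).comp Ef) ψ x :=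
  torus_form_symm n a s hA hEf hRf φ ψ

/-! ## §4. Toy -/

/-- Toy: at `n = 0`, `s = 1` the block chart of the tori is onto the one-point torus `Site d 1`. -/
example : Function.Surjective (fun yz : Site d 1 × (Fin d → Fin (0 + 1)) =>
    siteOf d ((0 + 1) * 1) (chart 0 (windowMap d 1 yz.1) yz.2)) :=
  siteOf_chart_surjective 0 1

end Summit.QuantumFields.BalabanUV.T4Continuum.NE7b.SupTorusDirichletForm

end
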